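import Summits.CriticalPhenomena.SAWScalingLimit.Theorems.SAWWeldingIdentificationWeldingLawOfLimitChordProxies
import Summits.CriticalPhenomena.SAWScalingLimit.Theorems.SAWWeldingIdentificationWeldingLawOfLimitSimple
import Summits.CriticalPhenomena.SAWScalingLimit.Theorems.SAWWeldingIdentificationRemovableLimitIdle
import Summits.CriticalPhenomena.SAWScalingLimit.Theorems.EventualTight.Negative.TightnessNecessary
import Summits.CriticalPhenomena.SAWScalingLimit.Theorems.SimpleSubseqLimits.Negative.SimpleSubseqLimitsNecessary

/-!
# The registered stubs of crux `WeldingLawOfLimit` are consequences of the conjunct (stmt-4502)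

Route `SAWWeldingIdentification` of `CriticalPhenomena/SAWScalingLimit`, crux (W)
`WeldingLawOfLimit` (stmt-CriticalPhenomena-4502), line `registered`, skeleton v4: registered stubs
`stub_simpleSubseqLimits` (= item stmt-CriticalPhenomena-4982 `SimpleSubseqLimits` by name) and
`stub_latticeWeldingLaw` (the LATTICE WELDING LAW: chord proxies of the critical `ℤ²` SAW whose
canonical-welding marginals converge to SLE_{8/3}'s). The companion files prove the equivalences
`SAWScalingLimit ⟺ lattice welding law` and `ApproxWeldingLaw ⟺ lattice welding law` MODULO the
route's other cruxes stmt-4982 and stmt-1372 taken as hypotheses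
(`sawScalingLimit_iff_latticeWeldingLaw_of_eventualTight`, `approxWeldingLaw_iff_latticeWeldingLaw`).
This file removes those hypotheses on the necessity side, using the necessity theorems of the two
shared cruxes already in the tree (`EventualTight.Negative`, `SimpleSubseqLimits.Negative`,
`SubseqIdentification.Negative`):

* `eventualTight_of_sawScalingLimit`, `simpleSubseqLimits_of_sawScalingLimit`,
  `weldingLawOfLimit_of_sawScalingLimit` — stmt-1372, stmt-4982 (= registered stub 1) and the crux
  itself follow from the conjunct `SAWScalingLimit`, unconditionally;
* `chordProxies_of_sawScalingLimit` — hence chord proxies of the walk exist under the conjunct;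
* `latticeWeldingLaw_of_sawScalingLimit'` — **the held stub `stub_latticeWeldingLaw` is NECESSARY
  for the conjunct, unconditionally** (no proxy / tightness / simplicity hypothesis left): a
  `stub-false` on either registered stub of this line would refute the Lawler–Schramm–Werner
  conjecture as typed (`not_sawScalingLimit_of_not_latticeWeldingLaw`);
* `registeredStubs_of_sawScalingLimit` — both registered stubs at once;
* `sawScalingLimit_iff_simpleSubseqLimits_and_eventualTight_and_latticeWeldingLaw` — **the
  conjunct is EQUIVALENT, unconditionally, to the conjunction of the route's open obligations in
  lattice form**: stmt-4982 ∧ stmt-1372 ∧ lattice welding law;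
* `sawScalingLimit_iff_weldingLawOfLimit_and_eventualTight` — and to crux (W) ∧ stmt-1372 (the
  route's honest content; stmt-4503 `RemovableLimit` is not load-bearing).

So the line `registered` bets on nothing beyond the conjunct: its two stubs and the route's
tightness crux are exactly as strong as `SAWScalingLimit`. No new definition, no named fact;
statements are inlined (the skeleton's `LatticeWeldingLaw`, verbatim).

References: Lawler–Schramm–Werner, Proc. Sympos. Pure Math. 72 (2004) §3.4.2, §4.1;
Billingsley, *Convergence of probability measures* (2nd ed., 1999), Thms 2.1, 3.1, 5.1;
Rohde–Schramm, Ann. Math. 161 (2005) Thm 6.1; Sheffield, Ann. Probab. 44 (2016) §1.4.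
-/

noncomputable section

open MeasureTheory Filter Topology Set
open scoped NNReal BoundedContinuousFunction
open Literature.Probability.RandomPlanarGeometry Literature.Probability.LatticeModels
open Literature.Probability.Process (preWienerMeasure)
open Summit.CriticalPhenomena.SAWScalingLimit.Theses

namespace Summit.CriticalPhenomena.SAWScalingLimit.Theorems.WeldingLawOfLimit

/-! ### The route's other cruxes and the crux itself follow from the conjunct -/

/-- **stmt-1372 is necessary**: `SAWScalingLimit → EventualTight` (route copy
`SAWWeldingIdentification.EventualTight`): convergence in law to chordal SLE_{8/3} along `𝓝[>] 0`
gives a tight set of pushed-forward laws on some `(0, δ₀]` (tree theorem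
`EventualTight.Negative.exists_isTightMeasureSet_image_of_convergesInLawToSLE`: Ulam tightness of
the limit on the Polish space `CurveClass ℂ` + compact containers). Billingsley (1999) Thm 5.1.
[folklore] -/
theorem eventualTight_of_sawScalingLimit (hS : _root_.SAWScalingLimit) :
    SAWWeldingIdentification.EventualTight := fun D a b hab =>
  Summit.CriticalPhenomena.SAWScalingLimit.Theorems.EventualTight.Negative.exists_isTightMeasureSet_image_of_convergesInLawToSLE
    hab (hS D a b hab)

/-- **stmt-4982 (registered stub 1) is necessary**: `SAWScalingLimit → SimpleSubseqLimits`: under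
convergence in law every subsequential weak limit is the SLE_{8/3} law
(`SimpleSubseqLimits.Negative.isSLELaw_of_weakLimit`), which is carried by the simple chords
(`SimpleSubseqLimits.Negative.ae_carrier_of_isSLELaw`, Rohde–Schramm 2005 Thm 6.1). [folklore] -/
theorem simpleSubseqLimits_of_sawScalingLimit (hS : _root_.SAWScalingLimit) :
    SAWLoopFugacityFlow.SimpleSubseqLimits := fun D a b hab _s _ν hs _hν hw =>
  Summit.CriticalPhenomena.SAWScalingLimit.Theorems.SimpleSubseqLimits.Negative.ae_carrier_of_isSLELaw
    (Summit.CriticalPhenomena.SAWScalingLimit.Theorems.SimpleSubseqLimits.Negative.isSLELaw_of_weakLimit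
      (hS D a b hab) hs hw)

/-- **The crux is necessary**: `SAWScalingLimit → WeldingLawOfLimit` — the conjunct gives the
identification of subsequential limits (stmt-0783,
`SubseqIdentification.Negative.subseqIdentification_of_sawScalingLimit`), which gives (W) by the
closing recipe `weldingLawOfLimit_of_subseqIdentification`. [folklore] -/
theorem weldingLawOfLimit_of_sawScalingLimit (hS : _root_.SAWScalingLimit) :
    SAWWeldingIdentification.WeldingLawOfLimit :=
  weldingLawOfLimit_of_subseqIdentification
    (Summit.CriticalPhenomena.SAWScalingLimit.Theorems.SubseqIdentification.Negative.subseqIdentification_of_sawScalingLimit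
      hS)

/-- **Chord proxies exist under the conjunct**: for every conformal rectangle `Q`, endpoint
approximation of `(Ω; a, b) = Q.chord 0 2` and positive `δₙ → 0` there are functions `cₙ` of the
walk, eventually almost surely simple chords of `(Ω; a, b)`, with
`P_δₙ {ε < dist ω.curve (cₙ ω)} → 0` for every `ε > 0`
(`chordProxies_of_eventualTight_of_simpleSubseqLimits` with both hypotheses discharged from
`SAWScalingLimit`). [folklore] -/
theorem chordProxies_of_sawScalingLimit (hS : _root_.SAWScalingLimit) :
    ∀ (Q : ConformalRectangle) (a b : ℝ → Site 2),
      SAW.IsEndpointApprox (Q.chord 0 2 (by decide)) a b →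
      ∀ (δs : ℕ → ℝ), (∀ n, 0 < δs n) → Tendsto δs atTop (𝓝 0) →
      ∃ c : (n : ℕ) → SAW.DomainSAW Q.carrier (δs n) (a (δs n)) (b (δs n)) → CurveClass ℂ,
        (∀ᶠ n in atTop, ∀ᵐ ω ∂(SAW.law Q.carrier (δs n) (a (δs n)) (b (δs n))),
          (Q.chord 0 2 (by decide)).IsSimpleChord (c n ω)) ∧
        (∀ ε : ℝ, 0 < ε →
          Tendsto (fun n => (SAW.law Q.carrier (δs n) (a (δs n)) (b (δs n))).real
            {ω | ε < dist ω.curve (c n ω)}) atTop (𝓝 0)) :=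
  chordProxies_of_eventualTight_of_simpleSubseqLimits (eventualTight_of_sawScalingLimit hS)
    (simpleSubseqLimits_of_sawScalingLimit hS)

/-! ### The held stub is necessary, unconditionally -/

/-- **The lattice welding law (registered stub `stub_latticeWeldingLaw`, verbatim) follows from
the conjunct `SAWScalingLimit`, unconditionally**: the chord proxies of
`chordProxies_of_sawScalingLimit` feed `latticeWeldingLaw_of_sawScalingLimit` (converging
together, chord support of the SLE_{8/3} law, `weldingMarginalsOfLimit`, uniqueness in law of
chordal SLE). So the held stub of line `registered` is not an over-strong bet: refuting it refutes
the Lawler–Schramm–Werner conjecture as typed. LSW (2004) §3.4.2; Billingsley (1999) Thm 3.1.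
[folklore] -/
theorem latticeWeldingLaw_of_sawScalingLimit' (hS : _root_.SAWScalingLimit) :
    ∀ (Q : ConformalRectangle) (a b : ℝ → Site 2),
      SAW.IsEndpointApprox (Q.chord 0 2 (by decide)) a b →
      ∀ (δs : ℕ → ℝ), (∀ n, 0 < δs n) → Tendsto δs atTop (𝓝 0) →
      ∃ c : (n : ℕ) → SAW.DomainSAW Q.carrier (δs n) (a (δs n)) (b (δs n)) → CurveClass ℂ,
        (∀ᶠ n in atTop, ∀ᵐ ω ∂(SAW.law Q.carrier (δs n) (a (δs n)) (b (δs n))),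
          (Q.chord 0 2 (by decide)).IsSimpleChord (c n ω)) ∧
        (∀ ε : ℝ, 0 < ε →
          Tendsto (fun n => (SAW.law Q.carrier (δs n) (a (δs n)) (b (δs n))).real
            {ω | ε < dist ω.curve (c n ω)}) atTop (𝓝 0)) ∧
        ∀ Γ : (NNReal → ℝ) → CurveClass ℂ,
          IsSLECurve ((8 : NNReal) / 3) (Q.chord 0 2 (by decide)) Γ →
          ∀ (k : ℕ) (x : Fin k → ℝ), (∀ i, 0 < x i) →
          ∀ g : BoundedContinuousFunction (Fin k → ℝ) ℝ,
            Tendsto (fun n => ∫ ω, g (fun i => conformalWelding Q (c n ω) (x i))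
                ∂(SAW.law Q.carrier (δs n) (a (δs n)) (b (δs n)))) atTop
              (𝓝 (∫ γ, g (fun i => conformalWelding Q γ (x i)) ∂(preWienerMeasure.map Γ))) :=
  latticeWeldingLaw_of_sawScalingLimit hS (chordProxies_of_sawScalingLimit hS)

/-- Contrapositive, for the disprover's record: a `stub-false` on `stub_latticeWeldingLaw` refutes
the conjunct `SAWScalingLimit` (every SAW route at once), not merely this line. [folklore] -/
theorem not_sawScalingLimit_of_not_latticeWeldingLaw
    (h : ¬ ∀ (Q : ConformalRectangle) (a b : ℝ → Site 2),
      SAW.IsEndpointApprox (Q.chord 0 2 (by decide)) a b →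
      ∀ (δs : ℕ → ℝ), (∀ n, 0 < δs n) → Tendsto δs atTop (𝓝 0) →
      ∃ c : (n : ℕ) → SAW.DomainSAW Q.carrier (δs n) (a (δs n)) (b (δs n)) → CurveClass ℂ,
        (∀ᶠ n in atTop, ∀ᵐ ω ∂(SAW.law Q.carrier (δs n) (a (δs n)) (b (δs n))),
          (Q.chord 0 2 (by decide)).IsSimpleChord (c n ω)) ∧
        (∀ ε : ℝ, 0 < ε →
          Tendsto (fun n => (SAW.law Q.carrier (δs n) (a (δs n)) (b (δs n))).real
            {ω | ε < dist ω.curve (c n ω)}) atTop (𝓝 0)) ∧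
        ∀ Γ : (NNReal → ℝ) → CurveClass ℂ,
          IsSLECurve ((8 : NNReal) / 3) (Q.chord 0 2 (by decide)) Γ →
          ∀ (k : ℕ) (x : Fin k → ℝ), (∀ i, 0 < x i) →
          ∀ g : BoundedContinuousFunction (Fin k → ℝ) ℝ,
            Tendsto (fun n => ∫ ω, g (fun i => conformalWelding Q (c n ω) (x i))
                ∂(SAW.law Q.carrier (δs n) (a (δs n)) (b (δs n)))) atTop
              (𝓝 (∫ γ, g (fun i => conformalWelding Q γ (x i)) ∂(preWienerMeasure.map Γ)))) :
    ¬ _root_.SAWScalingLimit := fun hS => h (latticeWeldingLaw_of_sawScalingLimit' hS)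

/-- **Both registered stubs of line `registered` follow from the conjunct**:
`SAWScalingLimit → stub_simpleSubseqLimits ∧ stub_latticeWeldingLaw` (signatures verbatim).
[folklore] -/
theorem registeredStubs_of_sawScalingLimit (hS : _root_.SAWScalingLimit) :
    SAWLoopFugacityFlow.SimpleSubseqLimits ∧
    ∀ (Q : ConformalRectangle) (a b : ℝ → Site 2),
      SAW.IsEndpointApprox (Q.chord 0 2 (by decide)) a b →
      ∀ (δs : ℕ → ℝ), (∀ n, 0 < δs n) → Tendsto δs atTop (𝓝 0) →
      ∃ c : (n : ℕ) → SAW.DomainSAW Q.carrier (δs n) (a (δs n)) (b (δs n)) → CurveClass ℂ,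
        (∀ᶠ n in atTop, ∀ᵐ ω ∂(SAW.law Q.carrier (δs n) (a (δs n)) (b (δs n))),
          (Q.chord 0 2 (by decide)).IsSimpleChord (c n ω)) ∧
        (∀ ε : ℝ, 0 < ε →
          Tendsto (fun n => (SAW.law Q.carrier (δs n) (a (δs n)) (b (δs n))).real
            {ω | ε < dist ω.curve (c n ω)}) atTop (𝓝 0)) ∧
        ∀ Γ : (NNReal → ℝ) → CurveClass ℂ,
          IsSLECurve ((8 : NNReal) / 3) (Q.chord 0 2 (by decide)) Γ →
          ∀ (k : ℕ) (x : Fin k → ℝ), (∀ i, 0 < x i) →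
          ∀ g : BoundedContinuousFunction (Fin k → ℝ) ℝ,
            Tendsto (fun n => ∫ ω, g (fun i => conformalWelding Q (c n ω) (x i))
                ∂(SAW.law Q.carrier (δs n) (a (δs n)) (b (δs n)))) atTop
              (𝓝 (∫ γ, g (fun i => conformalWelding Q γ (x i)) ∂(preWienerMeasure.map Γ))) :=
  ⟨simpleSubseqLimits_of_sawScalingLimit hS, latticeWeldingLaw_of_sawScalingLimit' hS⟩

/-! ### The conjunct equals the route's open obligations, unconditionally -/

/-- **`SAWScalingLimit ⟺ stmt-4982 ∧ stmt-1372 ∧ lattice welding law`, unconditionally.** (⇒):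
the three necessity theorems above; (⇐):
`sawScalingLimit_of_simpleSubseqLimits_of_latticeWeldingLaw_of_eventualTight` (the skeleton
composition `WeldingLawOfLimit_of` followed by the route's deciding chain). This sharpens
`sawScalingLimit_iff_latticeWeldingLaw_of_eventualTight`, where stmt-4982 and stmt-1372 were
standing hypotheses: the open content of route `SAWWeldingIdentification` in lattice form is
exactly as strong as the conjunct. [folklore] -/
theorem sawScalingLimit_iff_simpleSubseqLimits_and_eventualTight_and_latticeWeldingLaw :
    _root_.SAWScalingLimit ↔
    (SAWLoopFugacityFlow.SimpleSubseqLimits ∧ SAWWeldingIdentification.EventualTight ∧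
    ∀ (Q : ConformalRectangle) (a b : ℝ → Site 2),
      SAW.IsEndpointApprox (Q.chord 0 2 (by decide)) a b →
      ∀ (δs : ℕ → ℝ), (∀ n, 0 < δs n) → Tendsto δs atTop (𝓝 0) →
      ∃ c : (n : ℕ) → SAW.DomainSAW Q.carrier (δs n) (a (δs n)) (b (δs n)) → CurveClass ℂ,
        (∀ᶠ n in atTop, ∀ᵐ ω ∂(SAW.law Q.carrier (δs n) (a (δs n)) (b (δs n))),
          (Q.chord 0 2 (by decide)).IsSimpleChord (c n ω)) ∧
        (∀ ε : ℝ, 0 < ε →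
          Tendsto (fun n => (SAW.law Q.carrier (δs n) (a (δs n)) (b (δs n))).real
            {ω | ε < dist ω.curve (c n ω)}) atTop (𝓝 0)) ∧
        ∀ Γ : (NNReal → ℝ) → CurveClass ℂ,
          IsSLECurve ((8 : NNReal) / 3) (Q.chord 0 2 (by decide)) Γ →
          ∀ (k : ℕ) (x : Fin k → ℝ), (∀ i, 0 < x i) →
          ∀ g : BoundedContinuousFunction (Fin k → ℝ) ℝ,
            Tendsto (fun n => ∫ ω, g (fun i => conformalWelding Q (c n ω) (x i))
                ∂(SAW.law Q.carrier (δs n) (a (δs n)) (b (δs n)))) atTop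
              (𝓝 (∫ γ, g (fun i => conformalWelding Q γ (x i)) ∂(preWienerMeasure.map Γ)))) :=
  ⟨fun hS => ⟨simpleSubseqLimits_of_sawScalingLimit hS, eventualTight_of_sawScalingLimit hS,
      latticeWeldingLaw_of_sawScalingLimit' hS⟩,
    fun h => sawScalingLimit_of_simpleSubseqLimits_of_latticeWeldingLaw_of_eventualTight h.1 h.2.2
      h.2.1⟩

/-- **`SAWScalingLimit ⟺ WeldingLawOfLimit ∧ EventualTight`, unconditionally**: the honest
content of route `SAWWeldingIdentification` is its crux (W) (stmt-4502) and its tightness crux (T)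
(stmt-1372); the removability crux (R) (stmt-4503) is not load-bearing
(`RemovableLimit.sawScalingLimit_of_weldingLawOfLimit_of_eventualTight`), and conversely both (W)
and (T) follow from the conjunct. [folklore] -/
theorem sawScalingLimit_iff_weldingLawOfLimit_and_eventualTight :
    _root_.SAWScalingLimit ↔
    (SAWWeldingIdentification.WeldingLawOfLimit ∧ SAWWeldingIdentification.EventualTight) :=
  ⟨fun hS => ⟨weldingLawOfLimit_of_sawScalingLimit hS, eventualTight_of_sawScalingLimit hS⟩,
    fun h => RemovableLimit.sawScalingLimit_of_weldingLawOfLimit_of_eventualTight h.1 h.2⟩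

/-- **Given stmt-1372 alone, the crux ⟺ the lattice welding law ∧ stmt-4982** — the skeleton's
two registered stubs are, under the route's tightness crux, not just sufficient
(`WeldingLawOfLimit_of`) but necessary for (W): (W) ⇒ stmt-4982
(`simpleSubseqLimits_of_weldingLawOfLimit`) and (W) ∧ (T) ⇒ conjunct ⇒ lattice welding law.
[folklore] -/
theorem weldingLawOfLimit_iff_registeredStubs_of_eventualTight
    (hT : SAWWeldingIdentification.EventualTight) :
    SAWWeldingIdentification.WeldingLawOfLimit ↔
    (SAWLoopFugacityFlow.SimpleSubseqLimits ∧
    ∀ (Q : ConformalRectangle) (a b : ℝ → Site 2),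
      SAW.IsEndpointApprox (Q.chord 0 2 (by decide)) a b →
      ∀ (δs : ℕ → ℝ), (∀ n, 0 < δs n) → Tendsto δs atTop (𝓝 0) →
      ∃ c : (n : ℕ) → SAW.DomainSAW Q.carrier (δs n) (a (δs n)) (b (δs n)) → CurveClass ℂ,
        (∀ᶠ n in atTop, ∀ᵐ ω ∂(SAW.law Q.carrier (δs n) (a (δs n)) (b (δs n))),
          (Q.chord 0 2 (by decide)).IsSimpleChord (c n ω)) ∧
        (∀ ε : ℝ, 0 < ε →
          Tendsto (fun n => (SAW.law Q.carrier (δs n) (a (δs n)) (b (δs n))).real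
            {ω | ε < dist ω.curve (c n ω)}) atTop (𝓝 0)) ∧
        ∀ Γ : (NNReal → ℝ) → CurveClass ℂ,
          IsSLECurve ((8 : NNReal) / 3) (Q.chord 0 2 (by decide)) Γ →
          ∀ (k : ℕ) (x : Fin k → ℝ), (∀ i, 0 < x i) →
          ∀ g : BoundedContinuousFunction (Fin k → ℝ) ℝ,
            Tendsto (fun n => ∫ ω, g (fun i => conformalWelding Q (c n ω) (x i))
                ∂(SAW.law Q.carrier (δs n) (a (δs n)) (b (δs n)))) atTop
              (𝓝 (∫ γ, g (fun i => conformalWelding Q γ (x i)) ∂(preWienerMeasure.map Γ)))) :=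
  ⟨fun hW => registeredStubs_of_sawScalingLimit
      (RemovableLimit.sawScalingLimit_of_weldingLawOfLimit_of_eventualTight hW hT),
    fun h => weldingLawOfLimit_of_simpleSubseqLimits_of_latticeWeldingLaw h.1 h.2⟩

end Summit.CriticalPhenomena.SAWScalingLimit.Theorems.WeldingLawOfLimit

end
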